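import Literature.Analysis.FluidPDE.TaoCascadeProjection
import Literature.Analysis.FluidPDE.TaoAveragedSlotSobolev
import Literature.Analysis.FluidPDE.TaoAveragedEulerFormBound
import HarnessLib

/-!
# Tao's averaged Navier–Stokes setting: an `L²` toolkit for Fourier multipliers and band-limited fields

Support file for the discharge of **Lemma 4.1 (equations of motion)** of
T. Tao, *Finite time blowup for an averaged three-dimensional Navier–Stokes equation*,
J. Amer. Math. Soc. **29** (2016), 601–674 = arXiv:1402.0290v3 (held as `paper:arxiv-1402.0290`),
§4 pp. 21–23 (the named fact `equationsOfMotion` of `TaoCascadeMotion.lean`). The proof of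
Lemma 4.1 ("Taking Fourier transforms … Plancherel … taking inner products of (4.14) with
`ψ_{i,n}` … with `u_{i,n}`", p. 22) is Hilbert-space bookkeeping with the Fourier projections
`u_{i,n}` and the heat flow on `L²(ℝ³)`; this file supplies that bookkeeping over the accepted
setting of `TaoAveragedSobolev.lean` (`L2C = L²(ℝ³; ℂ³)`, `pairing`, `IsReal`, `fourierFn`,
`IsFourierDivFree`, `MemH10df`, `fourierMultiplier`, `heat`), `TaoAveragedConjugation.lean`
(`conjL2`, `fourier_conjL2`, `MemH10dfC`), `TaoAveragedRealParts.lean` (`IsFourierHermitian`),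
`TaoAveragedSlotSobolev.lean` (multipliers on `H¹⁰_df ⊗ ℂ`) and `TaoCascadeProjection.lean`
(Plancherel injectivity, realness of projections), complementing them:

* `pairing_swap`, `IsReal.pairing_eq_inner` — the bilinear pairing `⟨u, w⟩ = ∫ u · w` of a **real**
  field `u` with any `w` is the Hilbert inner product `⟪u, w⟫`; `inner_eq_integral_fourierFn` —
  Parseval `⟪u, w⟫ = ∫ ⟪û, ŵ⟫`;
* `fourierMultiplierCLM` — `m(D)` as a bounded operator, `‖m(D)‖ ≤ ‖m‖_∞`
  (`norm_fourierMultiplier_le_of_bound`), composition `m₁(D) m₂(D) = (m₁m₂)(D)`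
  (`fourierMultiplier_fourierMultiplier`), the Plancherel formulas
  `⟪u, m(D) w⟫ = ∫ m ⟪û, ŵ⟫` and self-adjointness for real symbols, negative
  semi-definiteness for non-positive symbols, contraction of every Sobolev norm (`|m| ≤ 1`) and
  preservation of **realness** for symbols obeying the reality condition only a.e. (e.g. even
  indicator / heat symbols, `IsReal.fourierMultiplier_of_ae`, via `IsFourierHermitian.isReal`);
* `IsBandLimited R f` (`f̂ = 0` off `R`) and its calculus: band-limited fields have every Sobolev
  norm finite (`IsBandLimited.eFourierSobolevNorm_le`), are fixed by `1_R(D)`, are orthogonal to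
  fields with disjoint Fourier support;
* `isFourierDivFree_intervalIntegral` — divergence-freeness is preserved by (interval) Bochner
  integrals (it is the joint kernel of the bounded functionals `f ↦ ⟪Φ, 𝓕 f⟫`,
  `Φ(ξ) = φ̄(ξ)(1+|ξ|)⁻¹ ξ`).

Everything here is proved; nothing is specific to the cascade operator.

## References

* T. Tao, J. Amer. Math. Soc. 29 (2016), 601–674, arXiv:1402.0290v3, §1.1 p. 6 (multipliers
  `\widehat{m(D)u} = m û`, "real" symbols `m(-ξ) = \overline{m(ξ)}`), §4 p. 22 (proof of
  Lemma 4.1). Key `Tao2016AveragedNS`.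
-/

noncomputable section

open MeasureTheory Set Filter FourierTransform
open scoped ENNReal NNReal ComplexConjugate InnerProductSpace

namespace Literature.Analysis.FluidPDE.Tao2016

/-- Local notation for physical / frequency space `ℝ³`. -/
local notation "ℝ³" => EuclideanSpace ℝ (Fin 3)
/-- Local notation for the complexified range `ℂ³`. -/
local notation "ℂ³" => EuclideanSpace ℂ (Fin 3)

/-! ### The bilinear pairing of a real field is the inner product -/

/-- The bilinear pairing is symmetric: `⟨u, w⟩ = ⟨w, u⟩`. [folklore] -/
theorem pairing_swap (u w : L2C) : pairing u w = pairing w u := by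
  unfold pairing cdot
  refine integral_congr_ae (Eventually.of_forall fun x => ?_)
  exact Finset.sum_congr rfl fun i _ => mul_comm _ _

/-- On `ℂ³`, the Hilbert inner product with a real first argument is the bilinear dot product. [folklore] -/
theorem inner_eq_cdot_of_im_eq_zero {a : ℂ³} (ha : ∀ i, (a i).im = 0) (b : ℂ³) :
    ⟪a, b⟫_ℂ = cdot a b := by
  rw [PiLp.inner_apply]
  unfold cdot
  refine Finset.sum_congr rfl fun i _ => ?_
  change b i * conj (a i) = a i * b i
  rw [Complex.conj_eq_iff_im.2 (ha i), mul_comm]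

/-- **For a real field `u`, the bilinear pairing `⟨u, w⟩ = ∫ u · w` is the inner product `⟪u, w⟫`
of `L²(ℝ³; ℂ³)`** (conjugating a real field does nothing). [folklore] -/
theorem IsReal.pairing_eq_inner {u : L2C} (hu : IsReal u) (w : L2C) : pairing u w = ⟪u, w⟫_ℂ := by
  rw [L2.inner_def]
  unfold pairing
  refine integral_congr_ae ?_
  filter_upwards [hu] with x hx
  exact (inner_eq_cdot_of_im_eq_zero hx _).symm

/-- **Parseval**: `⟪u, w⟫ = ∫ ⟪û(ξ), ŵ(ξ)⟫ dξ` (Mathlib's `Lp.inner_fourier_eq` and `L2.inner_def`). [folklore] -/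
theorem inner_eq_integral_fourierFn (u w : L2C) :
    ⟪u, w⟫_ℂ = ∫ ξ, ⟪fourierFn u ξ, fourierFn w ξ⟫_ℂ := by
  rw [← Lp.inner_fourier_eq, L2.inner_def]
  rfl

/-- The Parseval integrand `⟪û, ŵ⟫` is integrable. [folklore] -/
theorem integrable_inner_fourierFn (u w : L2C) :
    Integrable (fun ξ => ⟪fourierFn u ξ, fourierFn w ξ⟫_ℂ) (volume : Measure ℝ³) :=
  L2.integrable_inner (𝓕 u : L2C) (𝓕 w : L2C)

/-! ### Realness: algebra -/

/-- Negatives of real fields are real. [folklore] -/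
theorem IsReal.neg {u : L2C} (hu : IsReal u) : IsReal (-u) := by
  have h := hu.smul (-1)
  rwa [Complex.ofReal_neg, Complex.ofReal_one, neg_one_smul] at h

/-- Differences of real fields are real. [folklore] -/
theorem IsReal.sub {u v : L2C} (hu : IsReal u) (hv : IsReal v) : IsReal (u - v) := by
  rw [sub_eq_add_neg]
  exact hu.add hv.neg

/-- The zero field is real. [folklore] -/
theorem isReal_zero : IsReal (0 : L2C) :=
  memH10df_zero.2.1

/-- **A field with Hermitian Fourier transform is real** (converse of the tree's
`IsReal.isFourierHermitian`): `𝓕(ū) = \overline{û(-·)} = û`, so `ū = u`. [folklore] -/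
theorem IsFourierHermitian.isReal {u : L2C} (hu : IsFourierHermitian u) : IsReal u := by
  refine isReal_of_conjL2_eq (eq_of_fourierFn_ae_eq ?_)
  have hq := (Measure.measurePreserving_neg (volume : Measure ℝ³)).quasiMeasurePreserving
  filter_upwards [fourierFn_conjL2 u, hq.ae hu] with ξ h1 h2
  have h2' : conj3 (fourierFn u (-ξ)) = fourierFn u ξ := by rw [h2, neg_neg]
  rw [h1, h2']

/-! ### Fourier multipliers as bounded operators -/

/-- The inverse `L²` Fourier transform is an isometry. [folklore] -/
theorem norm_fourierInv_eq (f : L2C) : ‖(𝓕⁻ f : L2C)‖ = ‖f‖ :=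
  (Lp.fourierTransformₗᵢ ℝ³ ℂ³).symm.norm_map f

section Multiplier

variable (m : Lp ℂ ∞ (volume : Measure ℝ³))

/-- `‖m(D) u‖ ≤ ‖m‖_∞ ‖u‖` (Plancherel and Hölder `L^∞ · L² ⊆ L²`). [cite: Tao2016AveragedNS, §1.1 p. 6] -/
theorem norm_fourierMultiplier_le (u : L2C) : ‖fourierMultiplier m u‖ ≤ ‖m‖ * ‖u‖ := by
  unfold fourierMultiplier
  rw [norm_fourierInv_eq, ← Lp.norm_fourier_eq u]
  exact Lp.norm_smul_le _ _

/-- `‖m(D) u‖ ≤ C ‖u‖` whenever `|m| ≤ C` almost everywhere. [cite: Tao2016AveragedNS, §1.1 p. 6] -/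
theorem norm_fourierMultiplier_le_of_bound {C : ℝ} (hm : ∀ᵐ ξ ∂(volume : Measure ℝ³), ‖(m : ℝ³ → ℂ) ξ‖ ≤ C)
    (u : L2C) : ‖fourierMultiplier m u‖ ≤ C * ‖u‖ := by
  unfold fourierMultiplier
  rw [norm_fourierInv_eq, ← Lp.norm_fourier_eq u]
  refine Lp.norm_le_mul_norm_of_ae_le_mul ?_
  filter_upwards [Lp.coeFn_lpSMul (r := 2) m (𝓕 u : L2C), hm] with ξ h1 h2
  rw [h1, Pi.smul_apply', norm_smul]
  exact mul_le_mul_of_nonneg_right h2 (norm_nonneg _)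

/-- **The Fourier multiplier `m(D)` as a bounded operator on `L²(ℝ³; ℂ³)`** (Tao 2016, p. 6:
"`m(D)` … bounded on every Sobolev space"; here on `L²`, by Plancherel). [cite: Tao2016AveragedNS, §1.1 p. 6] -/
def fourierMultiplierCLM : L2C →L[ℂ] L2C :=
  LinearMap.mkContinuous
    { toFun := fourierMultiplier m
      map_add' := fourierMultiplier_add m
      map_smul' := fun c u => fourierMultiplier_smul m u c }
    ‖m‖ (norm_fourierMultiplier_le m)

/-- `fourierMultiplierCLM m u = m(D) u`. [folklore] -/
@[simp]
theorem fourierMultiplierCLM_apply (u : L2C) : fourierMultiplierCLM m u = fourierMultiplier m u := rfl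

/-- `‖m(D)‖ ≤ C` whenever `|m| ≤ C` a.e. (`C ≥ 0`). [cite: Tao2016AveragedNS, §1.1 p. 6] -/
theorem norm_fourierMultiplierCLM_le_of_bound {C : ℝ} (hC : 0 ≤ C)
    (hm : ∀ᵐ ξ ∂(volume : Measure ℝ³), ‖(m : ℝ³ → ℂ) ξ‖ ≤ C) : ‖fourierMultiplierCLM m‖ ≤ C :=
  ContinuousLinearMap.opNorm_le_bound _ hC (norm_fourierMultiplier_le_of_bound m hm)

/-- `m(D)` is continuous on `L²`. [folklore] -/
theorem continuous_fourierMultiplier : Continuous (fourierMultiplier m) :=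
  (fourierMultiplierCLM m).continuous

/-- `m(D) (u - v) = m(D) u - m(D) v`. [folklore] -/
theorem fourierMultiplier_sub (u v : L2C) :
    fourierMultiplier m (u - v) = fourierMultiplier m u - fourierMultiplier m v :=
  map_sub (fourierMultiplierCLM m) u v

/-- **Composition of multipliers**: `m₁(D) m₂(D) = m₃(D)` whenever `m₃ = m₁ m₂` a.e. [folklore] -/
theorem fourierMultiplier_fourierMultiplier (m₁ m₂ m₃ : Lp ℂ ∞ (volume : Measure ℝ³))
    (h : (m₃ : ℝ³ → ℂ) =ᵐ[volume] fun ξ => (m₁ : ℝ³ → ℂ) ξ * (m₂ : ℝ³ → ℂ) ξ) (u : L2C) :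
    fourierMultiplier m₁ (fourierMultiplier m₂ u) = fourierMultiplier m₃ u := by
  unfold fourierMultiplier
  rw [fourier_fourierInv_eq]
  congr 1
  apply Lp.ext
  filter_upwards [Lp.coeFn_lpSMul (r := 2) m₁ ((m₂ • (𝓕 u : L2C) : L2C)),
    Lp.coeFn_lpSMul (r := 2) m₂ (𝓕 u : L2C), Lp.coeFn_lpSMul (r := 2) m₃ (𝓕 u : L2C), h]
    with ξ h1 h2 h3 h4
  rw [h1, Pi.smul_apply', h2, Pi.smul_apply', h3, Pi.smul_apply', h4, smul_smul]

/-- Multipliers with a.e. equal symbols agree. [folklore] -/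
theorem fourierMultiplier_congr {m₁ m₂ : Lp ℂ ∞ (volume : Measure ℝ³)}
    (h : (m₁ : ℝ³ → ℂ) =ᵐ[volume] (m₂ : ℝ³ → ℂ)) (u : L2C) :
    fourierMultiplier m₁ u = fourierMultiplier m₂ u := by
  rw [Lp.ext h]

/-- **Plancherel for a multiplier on the right**: `⟪u, m(D) w⟫ = ∫ m(ξ) ⟪û(ξ), ŵ(ξ)⟫ dξ`. [folklore] -/
theorem inner_fourierMultiplier_right (u w : L2C) :
    ⟪u, fourierMultiplier m w⟫_ℂ = ∫ ξ, (m : ℝ³ → ℂ) ξ * ⟪fourierFn u ξ, fourierFn w ξ⟫_ℂ := by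
  rw [inner_eq_integral_fourierFn]
  refine integral_congr_ae ?_
  filter_upwards [fourierFn_fourierMultiplier m w] with ξ h
  rw [h, inner_smul_right]

/-- **Plancherel for a multiplier on the left**: `⟪m(D) u, w⟫ = ∫ \overline{m(ξ)} ⟪û(ξ), ŵ(ξ)⟫ dξ`. [folklore] -/
theorem inner_fourierMultiplier_left (u w : L2C) :
    ⟪fourierMultiplier m u, w⟫_ℂ = ∫ ξ, conj ((m : ℝ³ → ℂ) ξ) * ⟪fourierFn u ξ, fourierFn w ξ⟫_ℂ := by
  rw [inner_eq_integral_fourierFn]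
  refine integral_congr_ae ?_
  filter_upwards [fourierFn_fourierMultiplier m u] with ξ h
  rw [h, inner_smul_left]

/-- **A multiplier with real symbol is self-adjoint**: `⟪m(D) u, w⟫ = ⟪u, m(D) w⟫`. [folklore] -/
theorem inner_fourierMultiplier_comm (hm : ∀ᵐ ξ ∂(volume : Measure ℝ³), conj ((m : ℝ³ → ℂ) ξ) = (m : ℝ³ → ℂ) ξ)
    (u w : L2C) : ⟪fourierMultiplier m u, w⟫_ℂ = ⟪u, fourierMultiplier m w⟫_ℂ := by
  rw [inner_fourierMultiplier_left, inner_fourierMultiplier_right]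
  refine integral_congr_ae ?_
  filter_upwards [hm] with ξ h
  rw [h]

/-- `⟪u, m(D) u⟫ = ∫ m(ξ) ‖û(ξ)‖² dξ`. [folklore] -/
theorem inner_fourierMultiplier_self (u : L2C) :
    ⟪u, fourierMultiplier m u⟫_ℂ = ∫ ξ, (m : ℝ³ → ℂ) ξ * ((‖fourierFn u ξ‖ ^ 2 : ℝ) : ℂ) := by
  rw [inner_fourierMultiplier_right]
  refine integral_congr_ae (Eventually.of_forall fun ξ => ?_)
  dsimp only
  rw [inner_self_eq_norm_sq_to_K]
  norm_cast

/-- **A multiplier with non-positive real symbol is negative semi-definite**: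
`Re ⟪u, m(D) u⟫ ≤ 0` and `⟪u, m(D) u⟫` is real (e.g. the band-limited Laplacian). [folklore] -/
theorem inner_fourierMultiplier_self_of_nonpos (m₀ : ℝ³ → ℝ) (hm : (m : ℝ³ → ℂ) =ᵐ[volume] fun ξ => ((m₀ ξ : ℝ) : ℂ))
    (hm₀ : ∀ ξ, m₀ ξ ≤ 0) (u : L2C) :
    (⟪u, fourierMultiplier m u⟫_ℂ).re ≤ 0 ∧ (⟪u, fourierMultiplier m u⟫_ℂ).im = 0 := by
  have h : ⟪u, fourierMultiplier m u⟫_ℂ = ((∫ ξ, m₀ ξ * ‖fourierFn u ξ‖ ^ 2 : ℝ) : ℂ) := by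
    rw [inner_fourierMultiplier_self, ← integral_complex_ofReal]
    refine integral_congr_ae ?_
    filter_upwards [hm] with ξ hξ
    rw [hξ]
    push_cast
    ring
  rw [h, Complex.ofReal_re, Complex.ofReal_im]
  refine ⟨integral_nonpos fun ξ => ?_, rfl⟩
  exact mul_nonpos_of_nonpos_of_nonneg (hm₀ ξ) (sq_nonneg _)

/-- A multiplier with `|m| ≤ 1` contracts every Sobolev norm `H^s` (the tree's
`eFourierSobolevNorm_fourierMultiplier_le` with `‖m‖_∞ ≤ 1`). [folklore] -/
theorem eFourierSobolevNorm_fourierMultiplier_le_of_bound_one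
    (hm : ∀ᵐ ξ ∂(volume : Measure ℝ³), ‖(m : ℝ³ → ℂ) ξ‖ ≤ 1) (s : ℝ) (u : L2C) :
    FunctionSpaces.eFourierSobolevNorm s (fourierMultiplier m u) ≤
      FunctionSpaces.eFourierSobolevNorm s u := by
  refine (eFourierSobolevNorm_fourierMultiplier_le s m u).trans ?_
  refine mul_le_of_le_one_left zero_le ?_
  rw [Lp.enorm_def, eLpNorm_exponent_top]
  refine (eLpNormEssSup_le_of_ae_bound hm).trans ?_
  rw [ENNReal.ofReal_one]

/-- **Multipliers whose symbol obeys the reality condition a.e. preserve realness**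
(`\overline{m(ξ)} = m(-ξ)`; Tao's "real Fourier multipliers", p. 6 — here without smoothness,
e.g. for even real indicator and heat-type symbols): Hermitian symmetry of `û` is preserved
(tree's `IsFourierHermitian.fourierMultiplier`) and characterises realness. [cite: Tao2016AveragedNS, §1.1 p. 6] -/
theorem IsReal.fourierMultiplier_of_ae {u : L2C} (hu : IsReal u)
    (hm : ∀ᵐ ξ ∂(volume : Measure ℝ³), conj ((m : ℝ³ → ℂ) ξ) = (m : ℝ³ → ℂ) (-ξ)) :
    IsReal (Tao2016.fourierMultiplier m u) :=
  (hu.isFourierHermitian.fourierMultiplier hm).isReal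

/-- Multipliers with `|m| ≤ 1` obeying the reality condition a.e. preserve `H¹⁰_df`. [cite: Tao2016AveragedNS, §1.1 p. 6] -/
theorem MemH10df.fourierMultiplier_of_ae {u : L2C} (hu : MemH10df u)
    (hm : ∀ᵐ ξ ∂(volume : Measure ℝ³), conj ((m : ℝ³ → ℂ) ξ) = (m : ℝ³ → ℂ) (-ξ)) :
    MemH10df (Tao2016.fourierMultiplier m u) :=
  have h := hu.memH10dfC.fourierMultiplier m
  ⟨h.1, hu.2.1.fourierMultiplier_of_ae m hm, h.2⟩

end Multiplier

/-! ### Band-limited fields -/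

/-- `f ∈ L²(ℝ³; ℂ³)` is **band-limited to the frequency set `R`**: `f̂ = 0` a.e. off `R`
(e.g. Tao's projections `u_{i,n}`, `\widehat{u_{i,n}} = û 1_{(1+ε₀)ⁿ(Bᵢ ∪ -Bᵢ)}`, Lemma 4.1). [cite: Tao2016AveragedNS, Lemma 4.1] -/
def IsBandLimited (R : Set ℝ³) (f : L2C) : Prop :=
  ∀ᵐ ξ ∂(volume : Measure ℝ³), ξ ∉ R → fourierFn f ξ = 0

namespace IsBandLimited

variable {R : Set ℝ³} {f g : L2C}

/-- The zero field is band-limited to any set. [folklore] -/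
theorem zero (R : Set ℝ³) : IsBandLimited R (0 : L2C) := by
  unfold IsBandLimited
  filter_upwards [fourierFn_zero] with ξ hξ _
  rw [hξ, Pi.zero_apply]

/-- Band-limited fields form a subspace: sums. [folklore] -/
theorem add (hf : IsBandLimited R f) (hg : IsBandLimited R g) : IsBandLimited R (f + g) := by
  unfold IsBandLimited at *
  filter_upwards [hf, hg, fourierFn_add f g] with ξ h1 h2 h3 hξ
  rw [h3, h1 hξ, h2 hξ, add_zero]

/-- Band-limited fields form a subspace: scalar multiples. [folklore] -/
theorem smul (hf : IsBandLimited R f) (c : ℂ) : IsBandLimited R (c • f) := by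
  unfold IsBandLimited at *
  filter_upwards [hf, fourierFn_smul c f] with ξ h1 h2 hξ
  rw [h2, h1 hξ, smul_zero]

/-- Band-limited fields form a subspace: differences. [folklore] -/
theorem sub (hf : IsBandLimited R f) (hg : IsBandLimited R g) : IsBandLimited R (f - g) := by
  rw [sub_eq_add_neg, ← neg_one_smul ℂ g]
  exact hf.add (hg.smul _)

/-- Monotonicity in the frequency set. [folklore] -/
theorem mono {R' : Set ℝ³} (hf : IsBandLimited R f) (h : R ⊆ R') : IsBandLimited R' f := by
  unfold IsBandLimited at *
  filter_upwards [hf] with ξ h1 hξ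
  exact h1 fun h' => hξ (h h')

/-- A multiplier whose symbol vanishes off `R` produces band-limited fields. [folklore] -/
theorem of_symbol (m : Lp ℂ ∞ (volume : Measure ℝ³))
    (hm : ∀ᵐ ξ ∂(volume : Measure ℝ³), ξ ∉ R → (m : ℝ³ → ℂ) ξ = 0) (u : L2C) :
    IsBandLimited R (fourierMultiplier m u) := by
  unfold IsBandLimited
  filter_upwards [hm, fourierFn_fourierMultiplier m u] with ξ h1 h2 hξ
  rw [h2, h1 hξ, zero_smul]

/-- Multipliers preserve band-limitedness. [folklore] -/
theorem fourierMultiplier (hf : IsBandLimited R f) (m : Lp ℂ ∞ (volume : Measure ℝ³)) :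
    IsBandLimited R (fourierMultiplier m f) := by
  unfold IsBandLimited at *
  filter_upwards [hf, fourierFn_fourierMultiplier m f] with ξ h1 h2 hξ
  rw [h2, h1 hξ, smul_zero]

/-- Conjugation preserves band-limitedness to a symmetric frequency set. [folklore] -/
theorem conjL2 (hf : IsBandLimited R f) (hR : ∀ ξ, -ξ ∈ R → ξ ∈ R) : IsBandLimited R (conjL2 f) := by
  unfold IsBandLimited at *
  have hq := (Measure.measurePreserving_neg (volume : Measure ℝ³)).quasiMeasurePreserving
  filter_upwards [hq.ae hf, fourierFn_conjL2 f] with ξ h1 h2 hξ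
  rw [h2, h1 fun h => hξ (hR ξ h), map_zero]

/-- The real part of a field band-limited to a symmetric set is band-limited. [folklore] -/
theorem reL2 (hf : IsBandLimited R f) (hR : ∀ ξ, -ξ ∈ R → ξ ∈ R) : IsBandLimited R (reL2 f) :=
  (hf.add (hf.conjL2 hR)).smul _

/-- The imaginary part of a field band-limited to a symmetric set is band-limited. [folklore] -/
theorem imL2 (hf : IsBandLimited R f) (hR : ∀ ξ, -ξ ∈ R → ξ ∈ R) : IsBandLimited R (imL2 f) :=
  ((hf.conjL2 hR).sub hf).smul _

/-- **A band-limited field is orthogonal to every field whose Fourier transform vanishes on the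
band** (Parseval). [folklore] -/
theorem inner_eq_zero_of_ae (hf : IsBandLimited R f)
    (hg : ∀ᵐ ξ ∂(volume : Measure ℝ³), ξ ∈ R → fourierFn g ξ = 0) :
    ⟪f, g⟫_ℂ = 0 ∧ ⟪g, f⟫_ℂ = 0 := by
  have h : ∀ᵐ ξ ∂(volume : Measure ℝ³), ⟪fourierFn f ξ, fourierFn g ξ⟫_ℂ = 0 ∧
      ⟪fourierFn g ξ, fourierFn f ξ⟫_ℂ = 0 := by
    filter_upwards [hf, hg] with ξ h1 h2
    by_cases hξ : ξ ∈ R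
    · rw [h2 hξ, inner_zero_left, inner_zero_right]
      exact ⟨rfl, rfl⟩
    · rw [h1 hξ, inner_zero_left, inner_zero_right]
      exact ⟨rfl, rfl⟩
  constructor
  · rw [inner_eq_integral_fourierFn]
    exact (integral_congr_ae (h.mono fun ξ hξ => hξ.1)).trans (integral_zero _ _)
  · rw [inner_eq_integral_fourierFn]
    exact (integral_congr_ae (h.mono fun ξ hξ => hξ.2)).trans (integral_zero _ _)

/-- A multiplier whose symbol is `1` a.e. on the band fixes band-limited fields (e.g. the Fourier
projection `1_R(D)`). [folklore] -/
theorem fourierMultiplier_eq_self (hf : IsBandLimited R f) (m : Lp ℂ ∞ (volume : Measure ℝ³))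
    (hm : ∀ᵐ ξ ∂(volume : Measure ℝ³), ξ ∈ R → (m : ℝ³ → ℂ) ξ = 1) :
    Tao2016.fourierMultiplier m f = f := by
  apply (Lp.fourierTransformₗᵢ ℝ³ ℂ³).injective
  change (𝓕 (Tao2016.fourierMultiplier m f) : L2C) = 𝓕 f
  unfold Tao2016.fourierMultiplier
  rw [fourier_fourierInv_eq]
  apply Lp.ext
  filter_upwards [Lp.coeFn_lpSMul (r := 2) m (𝓕 f : L2C), hf, hm] with ξ h1 h2 h3
  rw [h1, Pi.smul_apply']
  by_cases hξ : ξ ∈ R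
  · rw [h3 hξ, one_smul]
  · change (m : ℝ³ → ℂ) ξ • fourierFn f ξ = fourierFn f ξ
    rw [h2 hξ, smul_zero]

/-- Testing a multiplier output against a band-limited field only sees the symbol on the band:
`⟪w, m(D) f⟫ = ⟪w, f⟫` if `m = 1` a.e. on the band of `w`. [folklore] -/
theorem inner_fourierMultiplier_eq_inner {w : L2C} (hw : IsBandLimited R w)
    (m : Lp ℂ ∞ (volume : Measure ℝ³))
    (hm : ∀ᵐ ξ ∂(volume : Measure ℝ³), ξ ∈ R → (m : ℝ³ → ℂ) ξ = 1) (f : L2C) :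
    ⟪w, Tao2016.fourierMultiplier m f⟫_ℂ = ⟪w, f⟫_ℂ := by
  rw [inner_fourierMultiplier_right, inner_eq_integral_fourierFn]
  refine integral_congr_ae ?_
  filter_upwards [hw, hm] with ξ h1 h2
  by_cases hξ : ξ ∈ R
  · rw [h2 hξ, one_mul]
  · rw [h1 hξ, inner_zero_left, mul_zero]

/-- **Band-limited fields have every Sobolev norm finite**, with the Bernstein-type bound
`‖f‖_{H^s} ≤ (1+ρ²)^{s/2} ‖f‖_{L²}` for a band inside `{|ξ| ≤ ρ}` and `s ≥ 0`. [folklore] -/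
theorem eFourierSobolevNorm_le {ρ : ℝ} (hR : R ⊆ Metric.closedBall (0 : ℝ³) ρ)
    (hf : IsBandLimited R f) {s : ℝ} (hs : 0 ≤ s) :
    FunctionSpaces.eFourierSobolevNorm s f ≤ ENNReal.ofReal ((1 + ρ ^ 2) ^ (s / 2)) * ‖f‖ₑ := by
  rw [← FunctionSpaces.eFourierSobolevNorm_zero_eq_enorm]
  unfold FunctionSpaces.eFourierSobolevNorm
  have hw : ∀ᵐ ξ ∂(volume : Measure ℝ³),
      ENNReal.ofReal ((1 + ‖ξ‖ ^ 2) ^ s) * ‖fourierFn f ξ‖ₑ ^ 2 ≤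
        ENNReal.ofReal ((1 + ρ ^ 2) ^ s) * (ENNReal.ofReal ((1 + ‖ξ‖ ^ 2) ^ (0 : ℝ)) *
          ‖fourierFn f ξ‖ₑ ^ 2) := by
    filter_upwards [hf] with ξ h1
    by_cases hξ : ξ ∈ R
    · have hn : ‖ξ‖ ≤ ρ := by simpa using hR hξ
      rw [Real.rpow_zero, ENNReal.ofReal_one, one_mul]
      have hle : (1 + ‖ξ‖ ^ 2) ^ s ≤ (1 + ρ ^ 2) ^ s :=
        Real.rpow_le_rpow (by positivity) (by nlinarith [pow_le_pow_left₀ (norm_nonneg _) hn 2]) hs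
      exact mul_le_mul_left (ENNReal.ofReal_le_ofReal hle) _
    · rw [h1 hξ, enorm_zero, zero_pow two_ne_zero, mul_zero, mul_zero, mul_zero]
  calc (∫⁻ ξ, ENNReal.ofReal ((1 + ‖ξ‖ ^ 2) ^ s) *
        ‖((𝓕 f : L2C) : ℝ³ → ℂ³) ξ‖ₑ ^ 2) ^ (1 / 2 : ℝ)
      ≤ (∫⁻ ξ, ENNReal.ofReal ((1 + ρ ^ 2) ^ s) * (ENNReal.ofReal ((1 + ‖ξ‖ ^ 2) ^ (0 : ℝ)) *
          ‖((𝓕 f : L2C) : ℝ³ → ℂ³) ξ‖ₑ ^ 2)) ^ (1 / 2 : ℝ) :=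
        ENNReal.rpow_le_rpow (lintegral_mono_ae hw) (by norm_num)
    _ = ENNReal.ofReal ((1 + ρ ^ 2) ^ (s / 2)) * (∫⁻ ξ, ENNReal.ofReal ((1 + ‖ξ‖ ^ 2) ^ (0 : ℝ)) *
          ‖((𝓕 f : L2C) : ℝ³ → ℂ³) ξ‖ₑ ^ 2) ^ (1 / 2 : ℝ) := by
        rw [lintegral_const_mul' _ _ ENNReal.ofReal_ne_top,
          ENNReal.mul_rpow_of_nonneg _ _ (by norm_num : (0 : ℝ) ≤ 1 / 2),
          ENNReal.ofReal_rpow_of_nonneg (by positivity) (by norm_num), ← Real.rpow_mul (by positivity),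
          mul_one_div]

/-- A band-limited field (bounded band) has finite `H¹⁰` norm. [folklore] -/
theorem eFourierSobolevNorm_lt_top {ρ : ℝ} (hR : R ⊆ Metric.closedBall (0 : ℝ³) ρ)
    (hf : IsBandLimited R f) {s : ℝ} (hs : 0 ≤ s) : FunctionSpaces.eFourierSobolevNorm s f < ∞ :=
  (hf.eFourierSobolevNorm_le hR hs).trans_lt (ENNReal.mul_lt_top ENNReal.ofReal_lt_top enorm_lt_top)

/-- A real, divergence-free field band-limited to a bounded band lies in `H¹⁰_df`. [folklore] -/
theorem memH10df {ρ : ℝ} (hR : R ⊆ Metric.closedBall (0 : ℝ³) ρ) (hf : IsBandLimited R f)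
    (hr : IsReal f) (hd : IsFourierDivFree f) : MemH10df f :=
  ⟨hf.eFourierSobolevNorm_lt_top hR (by norm_num), hr, hd⟩

/-- A divergence-free field band-limited to a bounded band lies in `H¹⁰_df ⊗ ℂ`. [folklore] -/
theorem memH10dfC {ρ : ℝ} (hR : R ⊆ Metric.closedBall (0 : ℝ³) ρ) (hf : IsBandLimited R f)
    (hd : IsFourierDivFree f) : MemH10dfC f :=
  ⟨hf.eFourierSobolevNorm_lt_top hR (by norm_num), hd⟩

end IsBandLimited

/-! ### Divergence-freeness is preserved by integrals -/

/-- The complexification of a real vector has real coordinates. [folklore] -/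
theorem complexify_im (ξ : ℝ³) (i : Fin 3) : (FunctionSpaces.EuclideanSpace.complexify ξ i).im = 0 := by
  rw [FunctionSpaces.EuclideanSpace.complexify_apply, Complex.ofReal_im]

/-- The **normalised divergence symbol** `(1+|ξ|)⁻¹ ξ · f̂(ξ)` of `f ∈ L²(ℝ³; ℂ³)`: an `L²`
function vanishing a.e. exactly when `f` is divergence free. [folklore] -/
def divSymbol (f : L2C) (ξ : ℝ³) : ℂ :=
  ((1 + ‖ξ‖ : ℝ) : ℂ)⁻¹ * cdot (FunctionSpaces.EuclideanSpace.complexify ξ) (fourierFn f ξ)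

/-- `|(1+|ξ|)⁻¹ ξ · f̂(ξ)| ≤ |f̂(ξ)|`. [folklore] -/
theorem norm_divSymbol_le (f : L2C) (ξ : ℝ³) : ‖divSymbol f ξ‖ ≤ ‖fourierFn f ξ‖ := by
  unfold divSymbol
  have hpos : (0 : ℝ) < 1 + ‖ξ‖ := by positivity
  rw [norm_mul, norm_inv, Complex.norm_real, Real.norm_eq_abs, abs_of_pos hpos]
  calc (1 + ‖ξ‖)⁻¹ * ‖cdot (FunctionSpaces.EuclideanSpace.complexify ξ) (fourierFn f ξ)‖
      ≤ (1 + ‖ξ‖)⁻¹ * (‖FunctionSpaces.EuclideanSpace.complexify ξ‖ * ‖fourierFn f ξ‖) :=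
        mul_le_mul_of_nonneg_left (norm_cdot_le _ _) (by positivity)
    _ = ((1 + ‖ξ‖)⁻¹ * ‖ξ‖) * ‖fourierFn f ξ‖ := by
        rw [FunctionSpaces.EuclideanSpace.complexify.norm_map, mul_assoc]
    _ ≤ 1 * ‖fourierFn f ξ‖ := by
        refine mul_le_mul_of_nonneg_right ?_ (norm_nonneg _)
        rw [inv_mul_le_iff₀ hpos]
        linarith [norm_nonneg ξ]
    _ = ‖fourierFn f ξ‖ := one_mul _

/-- The weight `(1+|ξ|)⁻¹` is continuous. [folklore] -/
theorem continuous_inv_one_add_norm : Continuous fun ξ : ℝ³ => ((1 + ‖ξ‖ : ℝ) : ℂ)⁻¹ := by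
  refine Continuous.inv₀ (f := fun ξ : ℝ³ => ((1 + ‖ξ‖ : ℝ) : ℂ)) (by fun_prop) fun ξ => ?_
  have h : (0 : ℝ) < 1 + ‖ξ‖ := by positivity
  exact_mod_cast h.ne'

/-- The divergence symbol is a.e.-strongly measurable. [folklore] -/
theorem aestronglyMeasurable_divSymbol (f : L2C) : AEStronglyMeasurable (divSymbol f) volume := by
  have hG : Continuous fun p : ℝ³ × ℂ³ =>
      ((1 + ‖p.1‖ : ℝ) : ℂ)⁻¹ * cdot (FunctionSpaces.EuclideanSpace.complexify p.1) p.2 :=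
    (continuous_inv_one_add_norm.comp continuous_fst).mul
      (continuous_cdot.comp
        ((FunctionSpaces.EuclideanSpace.complexify.continuous.comp continuous_fst).prodMk
          continuous_snd))
  have h2 : AEStronglyMeasurable (fun ξ : ℝ³ => (ξ, fourierFn f ξ)) (volume : Measure ℝ³) :=
    (aestronglyMeasurable_id (α := ℝ³) (μ := volume)).prodMk (aestronglyMeasurable_fourierFn f)
  have h3 := hG.comp_aestronglyMeasurable h2
  unfold divSymbol
  exact h3

/-- The divergence symbol is square integrable. [folklore] -/
theorem memLp_divSymbol (f : L2C) : MemLp (divSymbol f) 2 (volume : Measure ℝ³) :=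
  MemLp.of_le (Lp.memLp (𝓕 f : L2C)) (aestronglyMeasurable_divSymbol f)
    (Eventually.of_forall (norm_divSymbol_le f))

/-- `f` is divergence free iff its normalised divergence symbol vanishes a.e. [folklore] -/
theorem isFourierDivFree_iff_divSymbol (f : L2C) :
    IsFourierDivFree f ↔ divSymbol f =ᵐ[volume] 0 := by
  unfold IsFourierDivFree divSymbol
  constructor <;> intro h <;> filter_upwards [h] with ξ hξ
  · rw [Pi.zero_apply, hξ, mul_zero]
  · rw [Pi.zero_apply] at hξ
    refine (mul_eq_zero.1 hξ).resolve_left (inv_ne_zero ?_)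
    have hpos : (0 : ℝ) < 1 + ‖ξ‖ := by positivity
    exact_mod_cast hpos.ne'

/-- The **test fields** `Φ_φ(ξ) = \overline{φ(ξ)} (1+|ξ|)⁻¹ ξ` (`φ ∈ L²(ℝ³; ℂ)`), against which
divergence-freeness is tested: `⟪Φ_φ, f̂⟫ = ∫ φ · divSymbol f`. [folklore] -/
def divTestVec (φ : ℝ³ → ℂ) (ξ : ℝ³) : ℂ³ :=
  (conj (φ ξ) * ((1 + ‖ξ‖ : ℝ) : ℂ)⁻¹) • FunctionSpaces.EuclideanSpace.complexify ξ

/-- `|Φ_φ(ξ)| ≤ |φ(ξ)|`. [folklore] -/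
theorem norm_divTestVec_le (φ : ℝ³ → ℂ) (ξ : ℝ³) : ‖divTestVec φ ξ‖ ≤ ‖φ ξ‖ := by
  unfold divTestVec
  have hpos : (0 : ℝ) < 1 + ‖ξ‖ := by positivity
  rw [norm_smul, norm_mul, norm_inv, Complex.norm_real, Real.norm_eq_abs, abs_of_pos hpos,
    RCLike.norm_conj, FunctionSpaces.EuclideanSpace.complexify.norm_map, mul_assoc]
  refine mul_le_of_le_one_right (norm_nonneg _) ?_
  rw [inv_mul_le_iff₀ hpos]
  linarith [norm_nonneg ξ]

/-- The test fields of an `L²` function are `L²` fields. [folklore] -/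
theorem memLp_divTestVec {φ : ℝ³ → ℂ} (hφ : MemLp φ 2 (volume : Measure ℝ³)) :
    MemLp (divTestVec φ) 2 (volume : Measure ℝ³) := by
  refine MemLp.of_le hφ ?_ (Eventually.of_forall (norm_divTestVec_le φ))
  have hG : Continuous fun p : ℝ³ × ℂ =>
      (conj p.2 * ((1 + ‖p.1‖ : ℝ) : ℂ)⁻¹) • FunctionSpaces.EuclideanSpace.complexify p.1 :=
    ((Complex.continuous_conj.comp continuous_snd).mul
      (continuous_inv_one_add_norm.comp continuous_fst)).smul
      (FunctionSpaces.EuclideanSpace.complexify.continuous.comp continuous_fst)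
  have h2 : AEStronglyMeasurable (fun ξ : ℝ³ => (ξ, φ ξ)) (volume : Measure ℝ³) :=
    (aestronglyMeasurable_id (α := ℝ³) (μ := volume)).prodMk hφ.1
  have h3 := hG.comp_aestronglyMeasurable h2
  unfold divTestVec
  exact h3

/-- **`⟪Φ_φ, 𝓕 f⟫ = ∫ φ(ξ) (1+|ξ|)⁻¹ ξ · f̂(ξ) dξ`**: the functionals `f ↦ ⟪Φ_φ, 𝓕f⟫` compute the
weighted divergence symbol against `φ`. [folklore] -/
theorem inner_divTestVec_fourier {φ : ℝ³ → ℂ} (hφ : MemLp φ 2 (volume : Measure ℝ³)) (f : L2C) :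
    ⟪((memLp_divTestVec hφ).toLp _ : L2C), (𝓕 f : L2C)⟫_ℂ = ∫ ξ, φ ξ * divSymbol f ξ := by
  rw [L2.inner_def]
  refine integral_congr_ae ?_
  filter_upwards [MemLp.coeFn_toLp (memLp_divTestVec hφ)] with ξ hξ
  rw [hξ]
  change ⟪divTestVec φ ξ, fourierFn f ξ⟫_ℂ = φ ξ * divSymbol f ξ
  unfold divTestVec divSymbol
  rw [inner_smul_left, map_mul, Complex.conj_conj, map_inv₀, Complex.conj_ofReal,
    inner_eq_cdot_of_im_eq_zero (complexify_im ξ)]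
  ring

/-- A divergence-free field is annihilated by every test functional. [folklore] -/
theorem IsFourierDivFree.inner_divTestVec_eq_zero {f : L2C} (hf : IsFourierDivFree f)
    {φ : ℝ³ → ℂ} (hφ : MemLp φ 2 (volume : Measure ℝ³)) :
    ⟪((memLp_divTestVec hφ).toLp _ : L2C), (𝓕 f : L2C)⟫_ℂ = 0 := by
  rw [inner_divTestVec_fourier hφ]
  rw [isFourierDivFree_iff_divSymbol] at hf
  refine (integral_congr_ae ?_).trans (integral_zero _ _)
  filter_upwards [hf] with ξ hξ
  rw [hξ, Pi.zero_apply, mul_zero]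

/-- **Conversely, a field annihilated by every test functional is divergence free** (test with
`φ = \overline{divSymbol f}`: `∫ |divSymbol f|² = 0`). [folklore] -/
theorem isFourierDivFree_of_forall_inner_divTestVec {f : L2C}
    (h : ∀ (φ : ℝ³ → ℂ) (hφ : MemLp φ 2 (volume : Measure ℝ³)),
      ⟪((memLp_divTestVec hφ).toLp _ : L2C), (𝓕 f : L2C)⟫_ℂ = 0) :
    IsFourierDivFree f := by
  rw [isFourierDivFree_iff_divSymbol]
  have hφ : MemLp (fun ξ => conj (divSymbol f ξ)) 2 (volume : Measure ℝ³) :=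
    MemLp.of_le (memLp_divSymbol f)
      (Complex.continuous_conj.comp_aestronglyMeasurable (aestronglyMeasurable_divSymbol f))
      (Eventually.of_forall fun ξ => (RCLike.norm_conj _).le)
  have h0 := h _ hφ
  rw [inner_divTestVec_fourier hφ] at h0
  have h1 : ∫ ξ, conj (divSymbol f ξ) * divSymbol f ξ =
      ((∫ ξ, ‖divSymbol f ξ‖ ^ 2 : ℝ) : ℂ) := by
    rw [← integral_complex_ofReal]
    refine integral_congr_ae (Eventually.of_forall fun ξ => ?_)
    dsimp only
    rw [mul_comm, Complex.mul_conj, Complex.normSq_eq_norm_sq]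
  rw [h1] at h0
  have h2 : ∫ ξ, ‖divSymbol f ξ‖ ^ 2 = 0 := by exact_mod_cast h0
  have hint : Integrable (fun ξ => ‖divSymbol f ξ‖ ^ 2) (volume : Measure ℝ³) :=
    (memLp_two_iff_integrable_sq_norm (memLp_divSymbol f).1).1 (memLp_divSymbol f)
  have h3 := (integral_eq_zero_iff_of_nonneg (fun ξ => sq_nonneg _) hint).1 h2
  filter_upwards [h3] with ξ hξ
  have hξ' : ‖divSymbol f ξ‖ ^ 2 = 0 := hξ
  exact norm_eq_zero.1 (pow_eq_zero_iff two_ne_zero |>.1 hξ')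

/-- **Divergence-freeness is preserved by interval (Bochner) integrals**: if `F(s)` is
divergence free for `s ∈ uIoc a b` and interval integrable, so is `∫ₐᵇ F(s) ds` (the divergence-free
fields form the joint kernel of the bounded functionals `f ↦ ⟪Φ_φ, 𝓕 f⟫`, and bounded
functionals commute with the integral). [folklore] -/
theorem isFourierDivFree_intervalIntegral {F : ℝ → L2C} {a b : ℝ}
    (hF : IntervalIntegrable F volume a b) (h : ∀ s ∈ Set.uIoc a b, IsFourierDivFree (F s)) :
    IsFourierDivFree (∫ s in a..b, F s) := by
  refine isFourierDivFree_of_forall_inner_divTestVec fun φ hφ => ?_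
  set Φ : L2C := (memLp_divTestVec hφ).toLp _ with hΦ
  have h1 : (𝓕 (∫ s in a..b, F s) : L2C) = ∫ s in a..b, (𝓕 (F s) : L2C) :=
    ((Lp.fourierTransformₗᵢ ℝ³ ℂ³).toLinearIsometry.intervalIntegral_comp_comm F).symm
  have hF' : IntervalIntegrable (fun s => (𝓕 (F s) : L2C)) volume a b :=
    ⟨(Lp.fourierTransformₗᵢ ℝ³ ℂ³).toLinearIsometry.toContinuousLinearMap.integrable_comp hF.1,
      (Lp.fourierTransformₗᵢ ℝ³ ℂ³).toLinearIsometry.toContinuousLinearMap.integrable_comp hF.2⟩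
  have h2 : ⟪Φ, ∫ s in a..b, (𝓕 (F s) : L2C)⟫_ℂ = ∫ s in a..b, ⟪Φ, (𝓕 (F s) : L2C)⟫_ℂ := by
    rw [← innerSL_apply_apply ℂ, ← (innerSL ℂ Φ).intervalIntegral_comp_comm hF']
    rfl
  rw [h1, h2]
  refine intervalIntegral.integral_zero_ae (Eventually.of_forall fun s hs => ?_)
  rw [hΦ]
  exact (h s hs).inner_divTestVec_eq_zero hφ

end Literature.Analysis.FluidPDE.Tao2016
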